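import Mathlib
import Summits.NavierStokesRegularity.NavierStokesRegularity.Theorems.EulerZoomLiouvillePowerGaugeEulerLiouvilleVorticitySupportTools
import HarnessLib

/-!
# Conservation of the measure of the vorticity support along classical Euler flows — the limits
# (helper of the symmetry-free DSS stratum of the crux `EulerZoomLiouville.PowerGaugeEulerLiouville`,
# route №10, item stmt-NavierStokesRegularity-19832)

Helper file (theorems only; `--supports stmt-NavierStokesRegularity-19832`). Seat ns-typeII-p3 (cell
ns-regularity-ideate §B, D-0081). Sequel of `…VorticitySupportTools.lean`: from the cut-off identity with
source at `W = ψ_ε = |ω|²/(|ω|²+ε)`, dominated convergence `ε = 1/(j+1) → 0` on the space-time slab gives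
`½∫χ_R 𝟙_{S(T)} − ½∫χ_R 𝟙_{S(0)} = ∫₀ᵀ ½∫ Dχ_R[u(σ)] 𝟙_{S(σ)}` with `S(σ) = {x : curl u(σ) x ≠ 0}`
(`integral_cutoff_indicator_sub_eq`), hence `|…| ≤ T C B N/(2R)` when `vol S(σ) ≤ N`, and `R → ∞` (sequel
`…VorticitySupportConservation.lean`) gives `vol S(T) = vol S(0)` (Helmholtz: the vorticity support is
transported by the volume-preserving flow — proved WITHOUT flow maps).

WHAT THIS IS NOT: not NS, not the crux — a conservation law of classical Euler flows. [folklore]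
-/

noncomputable section

-- the summit and its single problem share the name `NavierStokesRegularity` (D-0017 nested layout)
set_option linter.dupNamespace false

open Set Function Filter Topology MeasureTheory Metric
open scoped NNReal ENNReal InnerProductSpace RealInnerProductSpace

namespace Summit.NavierStokesRegularity.NavierStokesRegularity.Theorems.PowerGaugeEulerLiouville.VorticitySupport

open Literature.Analysis Literature.Analysis.FluidPDE

section Cons

variable {T : ℝ} {v : ℝ → (EuclideanSpace ℝ (Fin 3)) → (EuclideanSpace ℝ (Fin 3))}
  {q : ℝ → (EuclideanSpace ℝ (Fin 3)) → ℝ}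

/-! ## Pointwise tools -/

/-- The vorticity support `{curl w ≠ 0}` of a `C²` field is open. [folklore] -/
theorem isOpen_vorticitySupport {w : (EuclideanSpace ℝ (Fin 3)) → (EuclideanSpace ℝ (Fin 3))}
    (hw : ContDiff ℝ 2 w) : IsOpen {x | curl w x ≠ 0} :=
  isOpen_ne_fun (contDiff_curl (n := 1) (hw.of_le (by norm_num))).continuous continuous_const

/-- The indicator of the vorticity support at a point. [folklore] -/
theorem indicator_support_eq {w : (EuclideanSpace ℝ (Fin 3)) → (EuclideanSpace ℝ (Fin 3))}
    (x : (EuclideanSpace ℝ (Fin 3))) :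
    {y | w y ≠ 0}.indicator (fun _ => (1 : ℝ)) x = if w x = 0 then 0 else 1 := by
  by_cases h : w x = 0 <;> simp [h]

/-- `0 ≤ ψ² ≤ 1`. [folklore] -/
theorem psi_sq_nonneg_le_one {ε : ℝ} (hε : 0 < ε) (w : (EuclideanSpace ℝ (Fin 3))) :
    0 ≤ (‖w‖ ^ 2 / (‖w‖ ^ 2 + ε)) ^ 2 ∧ (‖w‖ ^ 2 / (‖w‖ ^ 2 + ε)) ^ 2 ≤ 1 := by
  have h := psi_nonneg_le_one hε w
  exact ⟨sq_nonneg _, by nlinarith [h.1, h.2]⟩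

/-- `ψ² ≤ 𝟙_{w ≠ 0}`. [folklore] -/
theorem psi_sq_le_indicator {ε : ℝ} (hε : 0 < ε) {w : (EuclideanSpace ℝ (Fin 3)) → (EuclideanSpace ℝ (Fin 3))}
    (x : (EuclideanSpace ℝ (Fin 3))) :
    (‖w x‖ ^ 2 / (‖w x‖ ^ 2 + ε)) ^ 2 ≤ {y | w y ≠ 0}.indicator (fun _ => (1 : ℝ)) x := by
  rw [indicator_support_eq]
  by_cases hw : w x = 0
  · simp [hw]
  · simp only [hw, if_false]
    exact (psi_sq_nonneg_le_one hε (w x)).2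

/-- The gradient of the cut-off vanishes off the closed ball of radius `2R`. [folklore] -/
theorem fderiv_cutoff_eq_zero {R : ℝ} (hR : 0 < R) {x : (EuclideanSpace ℝ (Fin 3))}
    (hx : x ∉ closedBall (0 : (EuclideanSpace ℝ (Fin 3))) (2 * R)) :
    fderiv ℝ (cutoff (E := (EuclideanSpace ℝ (Fin 3))) R) x = 0 := by
  apply image_eq_zero_of_notMem_tsupport
  intro h
  exact hx ((tsupport_fderiv_subset ℝ).trans (tsupport_cutoff_subset hR) h)

/-- Pointwise bound `|Dχ_R(x)[w] a| ≤ (C/R) B · 𝟙_{B̄(0,2R)}(x) · |a|` for `‖w‖ ≤ B`. [folklore] -/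
theorem abs_fderiv_cutoff_mul_le {R C B : ℝ} (hR : 0 < R)
    (hC : ∀ x : (EuclideanSpace ℝ (Fin 3)), ‖fderiv ℝ (cutoff R) x‖ ≤ C / R)
    {w : (EuclideanSpace ℝ (Fin 3))} (hw : ‖w‖ ≤ B) (x : (EuclideanSpace ℝ (Fin 3))) (a : ℝ) :
    |fderiv ℝ (cutoff R) x w * a| ≤
      C / R * B * (closedBall (0 : (EuclideanSpace ℝ (Fin 3))) (2 * R)).indicator (fun _ => (1 : ℝ)) x * |a| := by
  have hC0 : 0 ≤ C / R := (norm_nonneg _).trans (hC 0)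
  have hB0 : 0 ≤ B := (norm_nonneg _).trans hw
  rw [abs_mul]
  gcongr
  by_cases hx : x ∈ closedBall (0 : (EuclideanSpace ℝ (Fin 3))) (2 * R)
  · rw [Set.indicator_of_mem hx, mul_one]
    calc |fderiv ℝ (cutoff R) x w| = ‖fderiv ℝ (cutoff R) x w‖ := (Real.norm_eq_abs _).symm
      _ ≤ ‖fderiv ℝ (cutoff R) x‖ * ‖w‖ := (fderiv ℝ (cutoff R) x).le_opNorm w
      _ ≤ C / R * B := by gcongr; exact hC x
  · rw [fderiv_cutoff_eq_zero hR hx]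
    simp [Set.indicator_of_notMem hx]

/-! ## Dominated convergence in `ε = 1/(j+1)` -/

/-- **Slice limit**: `∫ χ ψ_j(w)² → ∫ χ 𝟙_{w ≠ 0}` for a continuous field `w` and a continuous
compactly supported weight `χ`. [folklore] -/
theorem tendsto_integral_mul_psi_sq {w : (EuclideanSpace ℝ (Fin 3)) → (EuclideanSpace ℝ (Fin 3))}
    (hw : Continuous w) {χ : (EuclideanSpace ℝ (Fin 3)) → ℝ} (hχ : Continuous χ) (hχc : HasCompactSupport χ) :
    Tendsto (fun j : ℕ => ∫ x, χ x * (‖w x‖ ^ 2 / (‖w x‖ ^ 2 + ((j : ℝ) + 1)⁻¹)) ^ 2) atTop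
      (𝓝 (∫ x, χ x * {y | w y ≠ 0}.indicator (fun _ => (1 : ℝ)) x)) := by
  refine tendsto_integral_of_dominated_convergence (fun x => ‖χ x‖) ?_
    (hχ.integrable_of_hasCompactSupport hχc).norm ?_ ?_
  · intro j
    have hj : (0 : ℝ) < ((j : ℝ) + 1)⁻¹ := by positivity
    have hden : Continuous fun x => ‖w x‖ ^ 2 + ((j : ℝ) + 1)⁻¹ := (hw.norm.pow 2).add continuous_const
    have hne : ∀ x, ‖w x‖ ^ 2 + ((j : ℝ) + 1)⁻¹ ≠ 0 := fun x => by positivity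
    exact (hχ.mul (((hw.norm.pow 2).div hden hne).pow 2)).aestronglyMeasurable
  · intro j
    have hj : (0 : ℝ) < ((j : ℝ) + 1)⁻¹ := by positivity
    refine Eventually.of_forall fun x => ?_
    rw [norm_mul, Real.norm_of_nonneg (sq_nonneg _)]
    exact mul_le_of_le_one_right (norm_nonneg _) (psi_sq_nonneg_le_one hj (w x)).2
  · refine Eventually.of_forall fun x => ?_
    rw [indicator_support_eq]
    exact (tendsto_psi_sq (w x)).const_mul (χ x)

/-- **Slice limit of the flux term**: `∫ Dχ_R[w₁] ψ_j(w)² → ∫ Dχ_R[w₁] 𝟙_{w ≠ 0}` for continuous `w`,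
`w₁` with `‖w₁‖ ≤ B`. [folklore] -/
theorem tendsto_integral_fderiv_cutoff_mul_psi_sq {w w₁ : (EuclideanSpace ℝ (Fin 3)) → (EuclideanSpace ℝ (Fin 3))}
    (hw : Continuous w) (hw₁ : Continuous w₁) {B : ℝ} (hB : ∀ y, ‖w₁ y‖ ≤ B) {R : ℝ} (hR : 0 < R) :
    Tendsto (fun j : ℕ => ∫ x, fderiv ℝ (cutoff R) x (w₁ x) * (‖w x‖ ^ 2 / (‖w x‖ ^ 2 + ((j : ℝ) + 1)⁻¹)) ^ 2)
      atTop (𝓝 (∫ x, fderiv ℝ (cutoff R) x (w₁ x) * {y | w y ≠ 0}.indicator (fun _ => (1 : ℝ)) x)) := by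
  obtain ⟨C, hC0, hC⟩ := exists_norm_fderiv_cutoff_le (E := (EuclideanSpace ℝ (Fin 3)))
  have hχ : ContDiff ℝ 1 (cutoff (E := (EuclideanSpace ℝ (Fin 3))) R) := contDiff_cutoff R
  have hDχ : Continuous fun x => fderiv ℝ (cutoff (E := (EuclideanSpace ℝ (Fin 3))) R) x (w₁ x) :=
    (hχ.continuous_fderiv one_ne_zero).clm_apply hw₁
  set bound : (EuclideanSpace ℝ (Fin 3)) → ℝ := fun x =>
    C / R * B * (closedBall (0 : (EuclideanSpace ℝ (Fin 3))) (2 * R)).indicator (fun _ => (1 : ℝ)) x with hbound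
  have hbi : Integrable bound := by
    refine Integrable.const_mul ?_ _
    exact (integrable_indicator_iff measurableSet_closedBall).2
      (integrableOn_const (isCompact_closedBall _ _).measure_lt_top.ne)
  refine tendsto_integral_of_dominated_convergence bound ?_ hbi ?_ ?_
  · intro j
    have hj : (0 : ℝ) < ((j : ℝ) + 1)⁻¹ := by positivity
    have hden : Continuous fun x => ‖w x‖ ^ 2 + ((j : ℝ) + 1)⁻¹ := (hw.norm.pow 2).add continuous_const
    have hne : ∀ x, ‖w x‖ ^ 2 + ((j : ℝ) + 1)⁻¹ ≠ 0 := fun x => by positivity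
    exact (hDχ.mul (((hw.norm.pow 2).div hden hne).pow 2)).aestronglyMeasurable
  · intro j
    have hj : (0 : ℝ) < ((j : ℝ) + 1)⁻¹ := by positivity
    refine Eventually.of_forall fun x => ?_
    rw [Real.norm_eq_abs]
    refine (abs_fderiv_cutoff_mul_le hR (hC R hR) (hB x) x _).trans ?_
    rw [hbound, abs_of_nonneg (psi_sq_nonneg_le_one hj (w x)).1]
    exact mul_le_of_le_one_right (by
      have : 0 ≤ (closedBall (0 : (EuclideanSpace ℝ (Fin 3))) (2 * R)).indicator (fun _ => (1 : ℝ)) x :=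
        Set.indicator_nonneg (fun _ _ => zero_le_one) x
      have hB0 : 0 ≤ B := (norm_nonneg _).trans (hB 0)
      positivity) (psi_sq_nonneg_le_one hj (w x)).2
  · refine Eventually.of_forall fun x => ?_
    rw [indicator_support_eq]
    exact (tendsto_psi_sq (w x)).const_mul _

/-- **Slice limit of the source term**: `∫ χ_R F_j ψ_j → 0`, where `F_j` is the source of the
`ψ_j`-equation (bounded by `‖Dw₁‖/2 ≤ B/2`, tending to `0` pointwise). [folklore] -/
theorem tendsto_integral_cutoff_mul_source {w : (EuclideanSpace ℝ (Fin 3)) → (EuclideanSpace ℝ (Fin 3))}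
    (hw : Continuous w) {A : (EuclideanSpace ℝ (Fin 3)) → (EuclideanSpace ℝ (Fin 3)) →L[ℝ] (EuclideanSpace ℝ (Fin 3))}
    (hA : Continuous A) {B : ℝ} (hB : ∀ y, ‖A y‖ ≤ B) {R : ℝ} (hR : 0 < R) :
    Tendsto (fun j : ℕ => ∫ x, cutoff R x *
        (2 * ((j : ℝ) + 1)⁻¹ * ⟪w x, A x (w x)⟫ / (‖w x‖ ^ 2 + ((j : ℝ) + 1)⁻¹) ^ 2 *
          (‖w x‖ ^ 2 / (‖w x‖ ^ 2 + ((j : ℝ) + 1)⁻¹)))) atTop (𝓝 0) := by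
  have hχ : Continuous (cutoff (E := (EuclideanSpace ℝ (Fin 3))) R) := (contDiff_cutoff (n := 0) R).continuous
  have hχc : HasCompactSupport (cutoff (E := (EuclideanSpace ℝ (Fin 3))) R) := hasCompactSupport_cutoff hR
  have hB0 : 0 ≤ B := (norm_nonneg _).trans (hB 0)
  have h0 : (0 : ℝ) = ∫ x : (EuclideanSpace ℝ (Fin 3)), cutoff R x * 0 := by simp
  rw [h0]
  refine tendsto_integral_of_dominated_convergence (fun x => ‖cutoff R x‖ * (B / 2)) ?_
    ((hχ.integrable_of_hasCompactSupport hχc).norm.mul_const _) ?_ ?_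
  · intro j
    have hj : (0 : ℝ) < ((j : ℝ) + 1)⁻¹ := by positivity
    refine (hχ.mul ?_).aestronglyMeasurable
    have hden : Continuous fun x => ‖w x‖ ^ 2 + ((j : ℝ) + 1)⁻¹ := (hw.norm.pow 2).add continuous_const
    have hne : ∀ x, ‖w x‖ ^ 2 + ((j : ℝ) + 1)⁻¹ ≠ 0 := fun x => by positivity
    have hne2 : ∀ x, (‖w x‖ ^ 2 + ((j : ℝ) + 1)⁻¹) ^ 2 ≠ 0 := fun x => pow_ne_zero 2 (hne x)
    exact (((continuous_const.mul (hw.inner (hA.clm_apply hw))).div (hden.pow 2) hne2).mul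
      ((hw.norm.pow 2).div hden hne))
  · intro j
    have hj : (0 : ℝ) < ((j : ℝ) + 1)⁻¹ := by positivity
    refine Eventually.of_forall fun x => ?_
    rw [norm_mul]
    gcongr
    rw [Real.norm_eq_abs, abs_mul]
    have h1 := abs_source_le hj (w x) (A x)
    have h2 := psi_nonneg_le_one hj (w x)
    rw [abs_of_nonneg h2.1]
    calc |2 * ((j : ℝ) + 1)⁻¹ * ⟪w x, A x (w x)⟫ / (‖w x‖ ^ 2 + ((j : ℝ) + 1)⁻¹) ^ 2| *
          (‖w x‖ ^ 2 / (‖w x‖ ^ 2 + ((j : ℝ) + 1)⁻¹))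
        ≤ ‖A x‖ / 2 * 1 := mul_le_mul h1 h2.2 h2.1 (by positivity)
      _ ≤ B / 2 := by rw [mul_one]; gcongr; exact hB x
  · refine Eventually.of_forall fun x => ?_
    exact (tendsto_source_mul_psi (w x) (A x)).const_mul _

/-! ## The identity at fixed `R` with the limit indicator -/

/-- **The cut-off identity for the support indicator.** For a classical Euler flow on `[0, T]`
(`T > 0`) with `‖u‖, ‖∇u‖ ≤ B` on `[0, T]`, and `R > 0`:
`½∫χ_R 𝟙_{S(T)} − ½∫χ_R 𝟙_{S(0)} = ∫_{σ∈(0,T)} ½∫ Dχ_R[u(σ)] 𝟙_{S(σ)} dσ`, `S(σ) = {curl u(σ) ≠ 0}`.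
[folklore] -/
theorem integral_cutoff_indicator_sub_eq (hT : 0 < T) (hv : IsClassicalNSSolutionOn (Icc 0 T) 0 0 v q)
    {B : ℝ} (hB : ∀ σ ∈ Icc 0 T, ∀ y, ‖v σ y‖ ≤ B ∧ ‖fderiv ℝ (v σ) y‖ ≤ B) {R : ℝ} (hR : 0 < R) :
    2⁻¹ * (∫ x, cutoff R x * {y | curl (v T) y ≠ 0}.indicator (fun _ => (1 : ℝ)) x) -
      2⁻¹ * (∫ x, cutoff R x * {y | curl (v 0) y ≠ 0}.indicator (fun _ => (1 : ℝ)) x) =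
      ∫ σ in Ioo 0 T, 2⁻¹ * ∫ x, fderiv ℝ (cutoff R) x (v σ x) *
        {y | curl (v σ) y ≠ 0}.indicator (fun _ => (1 : ℝ)) x := by
  have hS : UniqueDiffOn ℝ (Icc 0 T) := uniqueDiffOn_Icc hT
  have hTm : T ∈ Icc 0 T := ⟨hT.le, le_rfl⟩
  have h0m : (0 : ℝ) ∈ Icc 0 T := ⟨le_rfl, hT.le⟩
  obtain ⟨C, hC0, hC⟩ := exists_norm_fderiv_cutoff_le (E := (EuclideanSpace ℝ (Fin 3)))
  have hχ1 : ContDiff ℝ 1 (cutoff (E := (EuclideanSpace ℝ (Fin 3))) R) := contDiff_cutoff R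
  have hχ : Continuous (cutoff (E := (EuclideanSpace ℝ (Fin 3))) R) := hχ1.continuous
  have hχc : HasCompactSupport (cutoff (E := (EuclideanSpace ℝ (Fin 3))) R) := hasCompactSupport_cutoff hR
  have hB0 : 0 ≤ B := (norm_nonneg _).trans (hB 0 h0m 0).1
  -- continuity data
  have hvc : ∀ σ ∈ Icc 0 T, Continuous (v σ) := fun σ hσ => (hv.contDiff_velocity hσ).continuous
  have hωc : ∀ σ ∈ Icc 0 T, Continuous (curl (v σ)) := fun σ hσ =>
    (contDiff_curl (n := 0) ((hv.contDiff_velocity hσ).of_le (by norm_cast))).continuous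
  have hAc : ∀ σ ∈ Icc 0 T, Continuous (fun x => fderiv ℝ (v σ) x) := fun σ hσ =>
    (hv.contDiff_velocity hσ).continuous_fderiv (by simp)
  -- the identity at level `j`
  have hid : ∀ j : ℕ,
      2⁻¹ * (∫ x, cutoff R x * (‖curl (v T) x‖ ^ 2 / (‖curl (v T) x‖ ^ 2 + ((j : ℝ) + 1)⁻¹)) ^ 2) -
        2⁻¹ * (∫ x, cutoff R x * (‖curl (v 0) x‖ ^ 2 / (‖curl (v 0) x‖ ^ 2 + ((j : ℝ) + 1)⁻¹)) ^ 2) =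
      ∫ σ in Ioo 0 T, (2⁻¹ * (∫ x, fderiv ℝ (cutoff R) x (v σ x) *
          (‖curl (v σ) x‖ ^ 2 / (‖curl (v σ) x‖ ^ 2 + ((j : ℝ) + 1)⁻¹)) ^ 2) +
        ∫ x, cutoff R x * (2 * ((j : ℝ) + 1)⁻¹ * ⟪curl (v σ) x, fderiv ℝ (v σ) x (curl (v σ) x)⟫ /
            (‖curl (v σ) x‖ ^ 2 + ((j : ℝ) + 1)⁻¹) ^ 2 *
          (‖curl (v σ) x‖ ^ 2 / (‖curl (v σ) x‖ ^ 2 + ((j : ℝ) + 1)⁻¹)))) := by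
    intro j
    have hj : (0 : ℝ) < ((j : ℝ) + 1)⁻¹ := by positivity
    refine integral_cutoff_sq_sub_eq_of_transport_source hT (isSmoothSpaceTimeOn_psi hS hv.smooth_velocity hj)
      (F := fun σ x => 2 * ((j : ℝ) + 1)⁻¹ * ⟪curl (v σ) x, fderiv ℝ (v σ) x (curl (v σ) x)⟫ /
        (‖curl (v σ) x‖ ^ 2 + ((j : ℝ) + 1)⁻¹) ^ 2)
      (fun σ hσ => (hv.contDiff_velocity hσ).of_le (by norm_cast)) (fun σ hσ => hv.divFree σ hσ)
      (fun σ hσ => ?_) (fun σ hσ x => timeDerivWithin_psi_eq hT hv hj hσ x) (fun σ hσ => ⟨B, hB σ hσ⟩) hR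
    exact ((continuous_const.mul ((hωc σ hσ).inner ((hAc σ hσ).clm_apply (hωc σ hσ)))).div
      (((hωc σ hσ).norm.pow 2).add continuous_const |>.pow 2) fun x => by positivity)
  -- the left-hand sides converge
  have hL : Tendsto (fun j : ℕ =>
      2⁻¹ * (∫ x, cutoff R x * (‖curl (v T) x‖ ^ 2 / (‖curl (v T) x‖ ^ 2 + ((j : ℝ) + 1)⁻¹)) ^ 2) -
        2⁻¹ * (∫ x, cutoff R x * (‖curl (v 0) x‖ ^ 2 / (‖curl (v 0) x‖ ^ 2 + ((j : ℝ) + 1)⁻¹)) ^ 2))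
      atTop (𝓝 (2⁻¹ * (∫ x, cutoff R x * {y | curl (v T) y ≠ 0}.indicator (fun _ => (1 : ℝ)) x) -
        2⁻¹ * (∫ x, cutoff R x * {y | curl (v 0) y ≠ 0}.indicator (fun _ => (1 : ℝ)) x))) :=
    ((tendsto_integral_mul_psi_sq (hωc T hTm) hχ hχc).const_mul _).sub
      ((tendsto_integral_mul_psi_sq (hωc 0 h0m) hχ hχc).const_mul _)
  -- the integrands of the right-hand sides: pointwise limit, uniform bound, measurability
  set G : ℕ → ℝ → ℝ := fun j σ => 2⁻¹ * (∫ x, fderiv ℝ (cutoff R) x (v σ x) *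
      (‖curl (v σ) x‖ ^ 2 / (‖curl (v σ) x‖ ^ 2 + ((j : ℝ) + 1)⁻¹)) ^ 2) +
    ∫ x, cutoff R x * (2 * ((j : ℝ) + 1)⁻¹ * ⟪curl (v σ) x, fderiv ℝ (v σ) x (curl (v σ) x)⟫ /
        (‖curl (v σ) x‖ ^ 2 + ((j : ℝ) + 1)⁻¹) ^ 2 *
      (‖curl (v σ) x‖ ^ 2 / (‖curl (v σ) x‖ ^ 2 + ((j : ℝ) + 1)⁻¹))) with hG
  have hGlim : ∀ σ ∈ Ioo 0 T, Tendsto (fun j => G j σ) atTop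
      (𝓝 (2⁻¹ * ∫ x, fderiv ℝ (cutoff R) x (v σ x) * {y | curl (v σ) y ≠ 0}.indicator (fun _ => (1 : ℝ)) x)) := by
    intro σ hσ
    have hσ' : σ ∈ Icc 0 T := Ioo_subset_Icc_self hσ
    have h1 := (tendsto_integral_fderiv_cutoff_mul_psi_sq (hωc σ hσ') (hvc σ hσ')
      (fun y => (hB σ hσ' y).1) hR).const_mul (2⁻¹ : ℝ)
    have h2 := tendsto_integral_cutoff_mul_source (hωc σ hσ') (hAc σ hσ') (fun y => (hB σ hσ' y).2) hR
    simpa [hG] using h1.add h2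
  -- uniform bound
  set K : ℝ := 2⁻¹ * (C / R * B * ∫ x, (closedBall (0 : (EuclideanSpace ℝ (Fin 3))) (2 * R)).indicator
      (fun _ => (1 : ℝ)) x) + (∫ x : (EuclideanSpace ℝ (Fin 3)), ‖cutoff R x‖) * (B / 2) with hK
  have hGbound : ∀ j : ℕ, ∀ σ ∈ Ioo 0 T, ‖G j σ‖ ≤ K := by
    intro j σ hσ
    have hσ' : σ ∈ Icc 0 T := Ioo_subset_Icc_self hσ
    have hj : (0 : ℝ) < ((j : ℝ) + 1)⁻¹ := by positivity
    rw [hG, Real.norm_eq_abs]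
    refine (abs_add_le _ _).trans (add_le_add ?_ ?_)
    · rw [abs_mul, abs_of_pos (by norm_num : (0 : ℝ) < 2⁻¹)]
      gcongr
      refine (abs_integral_le_integral_abs).trans ?_
      rw [← integral_const_mul]
      refine integral_mono_of_nonneg (Eventually.of_forall fun x => abs_nonneg _) ?_
        (Eventually.of_forall fun x => ?_)
      · exact ((integrable_indicator_iff measurableSet_closedBall).2
          (integrableOn_const (isCompact_closedBall _ _).measure_lt_top.ne)).const_mul _
      · refine (abs_fderiv_cutoff_mul_le hR (hC R hR) (hB σ hσ' x).1 x _).trans ?_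
        rw [abs_of_nonneg (psi_sq_nonneg_le_one hj _).1]
        exact mul_le_of_le_one_right (by
          have : 0 ≤ (closedBall (0 : (EuclideanSpace ℝ (Fin 3))) (2 * R)).indicator (fun _ => (1 : ℝ)) x :=
            Set.indicator_nonneg (fun _ _ => zero_le_one) x
          positivity) (psi_sq_nonneg_le_one hj _).2
    · refine (abs_integral_le_integral_abs).trans ?_
      rw [← integral_mul_const]
      refine integral_mono_of_nonneg (Eventually.of_forall fun x => abs_nonneg _)
        ((hχ.integrable_of_hasCompactSupport hχc).norm.mul_const _) (Eventually.of_forall fun x => ?_)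
      beta_reduce
      rw [abs_mul, ← Real.norm_eq_abs]
      gcongr
      rw [abs_mul, abs_of_nonneg (psi_nonneg_le_one hj _).1]
      calc |2 * ((j : ℝ) + 1)⁻¹ * ⟪curl (v σ) x, fderiv ℝ (v σ) x (curl (v σ) x)⟫ /
              (‖curl (v σ) x‖ ^ 2 + ((j : ℝ) + 1)⁻¹) ^ 2| *
            (‖curl (v σ) x‖ ^ 2 / (‖curl (v σ) x‖ ^ 2 + ((j : ℝ) + 1)⁻¹))
          ≤ ‖fderiv ℝ (v σ) x‖ / 2 * 1 :=
            mul_le_mul (abs_source_le hj _ _) (psi_nonneg_le_one hj _).2 (psi_nonneg_le_one hj _).1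
              (by positivity)
        _ ≤ B / 2 := by rw [mul_one]; gcongr; exact (hB σ hσ' x).2
  -- measurability in `σ`: continuity on `[0, T]` of the parametric integrals
  have hcontv : ContinuousOn (fun z : ℝ × (EuclideanSpace ℝ (Fin 3)) => v z.1 z.2) (Icc 0 T ×ˢ univ) :=
    hv.smooth_velocity.continuousOn
  have hcontω : ContinuousOn (fun z : ℝ × (EuclideanSpace ℝ (Fin 3)) => curl (v z.1) z.2) (Icc 0 T ×ˢ univ) := by
    have := (hv.smooth_velocity.isSmoothSpaceTimeOn_vorticity hS).continuousOn
    exact this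
  have hcontA : ContinuousOn (fun z : ℝ × (EuclideanSpace ℝ (Fin 3)) => fderiv ℝ (v z.1) z.2) (Icc 0 T ×ˢ univ) :=
    hv.smooth_velocity.continuousOn_fderiv_slice hS
  have hGcont : ∀ j : ℕ, ContinuousOn (G j) (Icc 0 T) := by
    intro j
    have hj : (0 : ℝ) < ((j : ℝ) + 1)⁻¹ := by positivity
    have hψc : ContinuousOn (fun z : ℝ × (EuclideanSpace ℝ (Fin 3)) =>
        ‖curl (v z.1) z.2‖ ^ 2 / (‖curl (v z.1) z.2‖ ^ 2 + ((j : ℝ) + 1)⁻¹)) (Icc 0 T ×ˢ univ) :=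
      (hcontω.norm.pow 2).div ((hcontω.norm.pow 2).add continuousOn_const) fun z _ => by positivity
    -- flux piece: `Dχ_R[v] ψ² = cutoff (2R) · (Dχ_R[v] ψ²)` (the gradient of `χ_R` lives in `B̄(0,2R)`)
    have hflux : ContinuousOn (fun σ => ∫ x, fderiv ℝ (cutoff R) x (v σ x) *
        (‖curl (v σ) x‖ ^ 2 / (‖curl (v σ) x‖ ^ 2 + ((j : ℝ) + 1)⁻¹)) ^ 2) (Icc 0 T) := by
      have h2R : (0 : ℝ) < 2 * R := by linarith
      have heq : ∀ σ, (∫ x, fderiv ℝ (cutoff R) x (v σ x) *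
          (‖curl (v σ) x‖ ^ 2 / (‖curl (v σ) x‖ ^ 2 + ((j : ℝ) + 1)⁻¹)) ^ 2) =
          ∫ x, cutoff (2 * R) x * (fderiv ℝ (cutoff R) x (v σ x) *
            (‖curl (v σ) x‖ ^ 2 / (‖curl (v σ) x‖ ^ 2 + ((j : ℝ) + 1)⁻¹)) ^ 2) := by
        intro σ
        refine integral_congr_ae (Eventually.of_forall fun x => ?_)
        beta_reduce
        by_cases hx : x ∈ closedBall (0 : (EuclideanSpace ℝ (Fin 3))) (2 * R)
        · rw [cutoff_eq_one h2R (mem_closedBall_zero_iff.1 hx), one_mul]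
        · simp [fderiv_cutoff_eq_zero hR hx]
      have h' : ContinuousOn (fun σ => ∫ x, cutoff (2 * R) x * (fderiv ℝ (cutoff R) x (v σ x) *
          (‖curl (v σ) x‖ ^ 2 / (‖curl (v σ) x‖ ^ 2 + ((j : ℝ) + 1)⁻¹)) ^ 2)) (Icc 0 T) :=
        continuousOn_integral_mul_of_continuousOn (G := fun z : ℝ × (EuclideanSpace ℝ (Fin 3)) =>
            fderiv ℝ (cutoff R) z.2 (v z.1 z.2) * (‖curl (v z.1) z.2‖ ^ 2 / (‖curl (v z.1) z.2‖ ^ 2 + ((j : ℝ) + 1)⁻¹)) ^ 2)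
          (contDiff_cutoff (n := 0) (2 * R)).continuous (hasCompactSupport_cutoff h2R)
          ((((hχ1.continuous_fderiv one_ne_zero).comp continuous_snd).continuousOn.clm_apply hcontv).mul
            (hψc.pow 2))
      exact h'.congr fun σ _ => heq σ
    have hsrc : ContinuousOn (fun σ => ∫ x, cutoff R x *
        (2 * ((j : ℝ) + 1)⁻¹ * ⟪curl (v σ) x, fderiv ℝ (v σ) x (curl (v σ) x)⟫ /
            (‖curl (v σ) x‖ ^ 2 + ((j : ℝ) + 1)⁻¹) ^ 2 *
          (‖curl (v σ) x‖ ^ 2 / (‖curl (v σ) x‖ ^ 2 + ((j : ℝ) + 1)⁻¹)))) (Icc 0 T) := by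
      have hne2 : ∀ z : ℝ × (EuclideanSpace ℝ (Fin 3)),
          (‖curl (v z.1) z.2‖ ^ 2 + ((j : ℝ) + 1)⁻¹) ^ 2 ≠ 0 := fun z => by positivity
      have hden2 : ContinuousOn (fun z : ℝ × (EuclideanSpace ℝ (Fin 3)) =>
          (‖curl (v z.1) z.2‖ ^ 2 + ((j : ℝ) + 1)⁻¹) ^ 2) (Icc 0 T ×ˢ univ) :=
        ((hcontω.norm.pow 2).add continuousOn_const).pow 2
      exact continuousOn_integral_mul_of_continuousOn (G := fun z : ℝ × (EuclideanSpace ℝ (Fin 3)) =>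
          2 * ((j : ℝ) + 1)⁻¹ * ⟪curl (v z.1) z.2, fderiv ℝ (v z.1) z.2 (curl (v z.1) z.2)⟫ /
            (‖curl (v z.1) z.2‖ ^ 2 + ((j : ℝ) + 1)⁻¹) ^ 2 *
          (‖curl (v z.1) z.2‖ ^ 2 / (‖curl (v z.1) z.2‖ ^ 2 + ((j : ℝ) + 1)⁻¹))) hχ hχc
        (((continuousOn_const.mul (hcontω.inner (hcontA.clm_apply hcontω))).div hden2
          fun z _ => hne2 z).mul hψc)
    have hsum := (hflux.const_smul (2⁻¹ : ℝ)).add hsrc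
    refine hsum.congr fun σ _ => ?_
    simp only [hG, Pi.add_apply, Pi.smul_apply, smul_eq_mul]
  -- dominated convergence in `σ`
  have hRlim : Tendsto (fun j : ℕ => ∫ σ in Ioo 0 T, G j σ) atTop
      (𝓝 (∫ σ in Ioo 0 T, 2⁻¹ * ∫ x, fderiv ℝ (cutoff R) x (v σ x) *
        {y | curl (v σ) y ≠ 0}.indicator (fun _ => (1 : ℝ)) x)) := by
    refine tendsto_integral_of_dominated_convergence (fun _ => K) ?_ ?_ ?_ ?_
    · intro j
      exact ((hGcont j).mono Ioo_subset_Icc_self).aestronglyMeasurable measurableSet_Ioo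
    · exact integrableOn_const (by simp)
    · intro j
      rw [ae_restrict_iff' measurableSet_Ioo]
      exact Eventually.of_forall fun σ hσ => hGbound j σ hσ
    · rw [ae_restrict_iff' measurableSet_Ioo]
      exact Eventually.of_forall fun σ hσ => hGlim σ hσ
  -- conclude by uniqueness of limits
  have heq : (fun j : ℕ =>
      2⁻¹ * (∫ x, cutoff R x * (‖curl (v T) x‖ ^ 2 / (‖curl (v T) x‖ ^ 2 + ((j : ℝ) + 1)⁻¹)) ^ 2) -
        2⁻¹ * (∫ x, cutoff R x * (‖curl (v 0) x‖ ^ 2 / (‖curl (v 0) x‖ ^ 2 + ((j : ℝ) + 1)⁻¹)) ^ 2)) =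
      fun j => ∫ σ in Ioo 0 T, G j σ := funext fun j => by rw [hid j]
  rw [heq] at hL
  exact tendsto_nhds_unique hL hRlim

end Cons

end Summit.NavierStokesRegularity.NavierStokesRegularity.Theorems.PowerGaugeEulerLiouville.VorticitySupport

end
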